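import Literature.NumberTheory.Weil1964.UnitaryArchTopFormDiscConstant            -- ★ `one_sub_norm_sq_chart`, `lintegral_sq_one_sub_norm_sq_chart_eq_lintegral_cayleyWeightC_one`, `lintegral_localTopFormHaar_diagonal_one_neg_one_eq`
import Literature.NumberTheory.Weil1964.UnitaryArchLocalTopFormHaarCongrTransport   -- ★ `map_conj_archLocalTopFormHaar`
import Literature.NumberTheory.Weil1964.UnitaryArchLocalCayleyWeightMassTwo         -- ★ `lintegral_cayleyWeightC_two` (`π³∕2`)
import Literature.NumberTheory.Automorphic.UnitaryGroupFormTransport                -- ★ `unitaryGroupOfFormCongrOfEq` (`g ↦ T g T⁻¹`)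
import HarnessLib

/-!
# K2 ∕ E5 «TamagawaUnitary» — FILE `K2E5QuatArchIndefiniteMassU` ((19) road (R-indef), organ (Ind-U)): THE `U`-SIDE NUMBER AT AN INDEFINITE PLACE —
# `∫_{U(h_w)} |(T⁻¹ u T)₀₀|⁻⁴ dμ^TF_w(u) = π³∕2` for `Tᴴ h_w T = diag(1, −1)`

Cell `pub/hodgecm-mathlib`, Track B «K2-LIT», engine E5, crux H413 = `stmt-HodgeConjecture-24833`, route `route-HodgeConjecture-HCCMUnconditional`; dealer K2E5-plan (g2)
(RULING 2026-09-04T00:42Z: (R-indef) load-bearing); prover seat hodgecm-mathlib-K2E5-p22 (g2).  THEOREMS ONLY; lane `--supports stmt-HodgeConjecture-24833 --as helper`.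

THE MATHEMATICS (road (α′) «the test function `|h₀₀|⁻⁴`», no Jacobian).  On `U(1,1) = U(J₋)(ℂ)`, `J₋ = diag(1,−1)`, the function `g ↦ |g₀₀|⁻⁴ = (1 − |π g|²)²`
(`π g = g₁₀∕g₀₀` the disc coordinate, ★ `one_sub_norm_sq_chart`) has top-form integral `∫_{U(1,1)} (1 − |π g|²)² dμ^TF = ∫_{𝔲(2)} w₀ dλ` (★ `UnitaryArchTopFormDiscConstant`, the twist
`X ↦ J₋X`, no Jacobian) `= π³∕2` (★ `lintegral_cayleyWeightC_two`).  At a complex place `w` where `h_w = σ_w(h)` is INDEFINITE, i.e. `Tᴴ h_w T = J₋` for some `T ∈ GL₂(ℂ)`,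
`u ↦ T⁻¹ u T : U(h_w) ≅ U(J₋)` carries `μ^TF_w(h)` to `μ^TF_w(diag(1,−1))` (★ `map_conj_archLocalTopFormHaar`, hypothesis-free congruence transport), so
**`∫_{U(h_w)} |(T⁻¹ u T)₀₀|⁻⁴ dμ^TF_w = π³∕2`** (`lintegral_inv_normSq_sq_archLocalTopFormHaar_of_indefinite`).  Since `|(T⁻¹ (z·k) T)₀₀| = |(T⁻¹ k T)₀₀|` for a scalar `z ∈ U(1)`, the
fibre integrals over `SU(h_w)` are constant and ★ `K2E5HaarPinWeilLIntegral` turns this into `∫_{SU(h_w)} |(T⁻¹kT)₀₀|⁻⁴ dρU = (π³∕2)∕π = π²∕2` (assembly file).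

HONEST LABEL.  HC_CM is proved only modulo the 7 printed citations (2 remaining named inputs: hLiu418 = `stmt-HodgeConjecture-24832`, h413 = `stmt-HodgeConjecture-24833`)
until rung 0 closes; this file moves no counter.

## References
* [Helgason2000] S. Helgason, *Groups and Geometric Analysis*, AMS Math. Surveys Monogr. 83 (2000), Introduction §4; Ch. I §1 Thm. 1.14 p. 96.
* [Rogawski1990] J. D. Rogawski, *Automorphic Representations of Unitary Groups in Three Variables*, Ann. of Math. Stud. 123 (1990), §1.7 p. 6.
* [Macdonald1980] I. G. Macdonald, *The volume of a compact Lie group*, Invent. Math. 56 (1980), 93–95.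
-/

set_option autoImplicit false
-- the mandated namespace repeats the single-problem summit's segment (`HodgeConjecture.HodgeConjecture`)
set_option linter.dupNamespace false

noncomputable section

open NumberField NumberField.InfinitePlace MeasureTheory MeasureTheory.Measure Matrix Complex Real
open scoped Matrix MatrixGroups ENNReal NNReal ComplexConjugate
open Literature.NumberTheory.Automorphic Literature.NumberTheory.Automorphic.UnitaryGroup Literature.NumberTheory.Weil1964.UnitaryArchLocalTopForm
open Literature.Analysis.Complex

namespace Summit.HodgeConjecture.HodgeConjecture.Cruxes.H413.K2E5QuatArchLocal

/-! ## §1 The model carrier `J₋ = diag(1, −1)`: `∫_{U(1,1)} |g₀₀|⁻⁴ dμ^TF = π³∕2` -/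

variable [MeasurableSpace (GL (Fin 2) ℂ)] [BorelSpace (GL (Fin 2) ℂ)]

/-- **`∫_{U(1,1)} |g₀₀|⁻⁴ dμ^TF(J₋) = π³∕2`** — `|g₀₀|⁻⁴ = (1 − |π g|²)²` (★ `one_sub_norm_sq_chart`), the disc-constant twist (★) and ★ `lintegral_cayleyWeightC_two`.  (The CM field `L` and
the place `w` parametrise ★ FILE 4's chart reading only.) [cite: Helgason2000, Introduction §4; Ch. I §1 Thm. 1.14 p. 96] [cite: Macdonald1980, p. 93] -/
theorem lintegral_inv_normSq_sq_localTopFormHaar_diagonal (L : Type) [Field L] [NumberField L] [IsCMField L] (w : {w : InfinitePlace L // IsComplex w}) :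
    ∫⁻ g, ENNReal.ofReal (((‖((g : GL (Fin 2) ℂ) : Matrix (Fin 2) (Fin 2) ℂ) 0 0‖ ^ 2)⁻¹) ^ 2) ∂(localTopFormHaar 2 (Matrix.diagonal ![(1 : ℂ), -1])) =
      ENNReal.ofReal (π ^ 3 / 2) := by
  letI : MeasurableSpace ↥(skewC 2 (Matrix.diagonal ![(1 : ℂ), -1])) := borel _
  haveI : BorelSpace ↥(skewC 2 (Matrix.diagonal ![(1 : ℂ), -1])) := ⟨rfl⟩
  letI : MeasurableSpace ↥(skewC 2 (1 : Matrix (Fin 2) (Fin 2) ℂ)) := borel _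
  haveI : BorelSpace ↥(skewC 2 (1 : Matrix (Fin 2) (Fin 2) ℂ)) := ⟨rfl⟩
  have h1 : ∀ g : unitaryGroupOfForm (starRingEnd ℂ) (Matrix.diagonal ![(1 : ℂ), -1]),
      ENNReal.ofReal (((‖((g : GL (Fin 2) ℂ) : Matrix (Fin 2) (Fin 2) ℂ) 0 0‖ ^ 2)⁻¹) ^ 2) =
        ENNReal.ofReal ((1 - ‖discMoebius (((g : GL (Fin 2) ℂ) : Matrix (Fin 2) (Fin 2) ℂ)) 0‖ ^ 2) ^ 2) := fun g => by
    rw [one_sub_norm_sq_chart g]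
  simp_rw [h1]
  rw [lintegral_sq_one_sub_norm_sq_chart_eq_lintegral_cayleyWeightC_one _ (fun _ hg => lintegral_localTopFormHaar_diagonal_one_neg_one_eq L w hg),
    lintegral_cayleyWeightC_two rfl]

/-- The same for the RATIONAL model carrier `diag(1, −1) ∈ M₂(L)` at the place `w` (`σ_w diag(1,−1) = diag(1,−1)`, ★ `map_embedding_diagonal_one_neg_one`).
[cite: Helgason2000, Introduction §4] [cite: Rogawski1990, §1.7 p. 6] -/
theorem lintegral_inv_normSq_sq_archLocalTopFormHaar_diagonal (L : Type) [Field L] [NumberField L] [IsCMField L] (w : {w : InfinitePlace L // IsComplex w}) :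
    ∫⁻ g, ENNReal.ofReal (((‖((g : GL (Fin 2) ℂ) : Matrix (Fin 2) (Fin 2) ℂ) 0 0‖ ^ 2)⁻¹) ^ 2) ∂(archLocalTopFormHaar L 2 (Matrix.diagonal ![(1 : L), -1]) w) =
      ENNReal.ofReal (π ^ 3 / 2) := by
  have key : ∀ Jw : Matrix (Fin 2) (Fin 2) ℂ, Jw = Matrix.diagonal ![(1 : ℂ), -1] →
      ∫⁻ g, ENNReal.ofReal (((‖((g : GL (Fin 2) ℂ) : Matrix (Fin 2) (Fin 2) ℂ) 0 0‖ ^ 2)⁻¹) ^ 2) ∂(localTopFormHaar 2 Jw) = ENNReal.ofReal (π ^ 3 / 2) := by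
    rintro Jw rfl
    exact lintegral_inv_normSq_sq_localTopFormHaar_diagonal L w
  exact key _ (map_embedding_diagonal_one_neg_one L w)

/-! ## §2 A general indefinite place: `Tᴴ h_w T = diag(1, −1)` -/

variable (L : Type) [Field L] [NumberField L] [IsCMField L] (w : {w : InfinitePlace L // IsComplex w}) (Ha : Matrix (Fin 2) (Fin 2) L)

omit [MeasurableSpace (GL (Fin 2) ℂ)] [BorelSpace (GL (Fin 2) ℂ)] in
/-- `diag(1, −1) ∈ M₂(L)` is `c`-hermitian with unit determinant. [folklore] -/
theorem diagonal_one_neg_one_hermitian_and_isUnit :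
    ((Matrix.diagonal ![(1 : L), -1]).map (IsCMField.complexConj L))ᵀ = Matrix.diagonal ![(1 : L), -1] ∧ IsUnit (Matrix.diagonal ![(1 : L), -1]).det := by
  refine ⟨?_, ?_⟩
  · rw [Matrix.diagonal_map (map_zero _), Matrix.diagonal_transpose]
    congr 1
    funext i
    fin_cases i <;> simp
  · rw [Matrix.det_diagonal, isUnit_iff_ne_zero]
    exact Finset.prod_ne_zero_iff.2 fun i _ => by fin_cases i <;> simp

/-- **THE `U`-SIDE NUMBER AT AN INDEFINITE PLACE**: for `h` hermitian with `det h ≠ 0` and `T ∈ GL₂(ℂ)` with `Tᴴ h_w T = diag(1, −1)` (signature `(1,1)` at `w`),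
`∫_{U(h_w)} |(T⁻¹ u T)₀₀|⁻⁴ dμ^TF_w(u) = π³∕2` (★ congruence transport `u ↦ T⁻¹uT` to the model + §1). [cite: Helgason2000, Ch. I §1 Thm. 1.14 p. 96] [cite: Rogawski1990, §1.7 p. 6] -/
theorem lintegral_inv_normSq_sq_archLocalTopFormHaar_of_indefinite (hHa : (Ha.map (cmConjRingHom L)).transpose = Ha) (hdet : Ha.det ≠ 0)
    {T : GL (Fin 2) ℂ} (hT : formCongr (starRingEnd ℂ) T (Ha.map w.1.embedding) = Matrix.diagonal ![(1 : ℂ), -1]) :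
    ∫⁻ u, ENNReal.ofReal (((‖(((T⁻¹ : GL (Fin 2) ℂ) : Matrix (Fin 2) (Fin 2) ℂ) * ((u : GL (Fin 2) ℂ) : Matrix (Fin 2) (Fin 2) ℂ) * (T : Matrix (Fin 2) (Fin 2) ℂ)) 0 0‖ ^ 2)⁻¹) ^ 2)
        ∂(archLocalTopFormHaar L 2 Ha w) = ENNReal.ofReal (π ^ 3 / 2) := by
  obtain ⟨hherm₂, hdet₂⟩ := diagonal_one_neg_one_hermitian_and_isUnit L
  have h : formCongr (starRingEnd ℂ) T (Ha.map w.1.embedding) = (Matrix.diagonal ![(1 : L), -1]).map w.1.embedding := by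
    rw [hT, map_embedding_diagonal_one_neg_one L w]
  set Φ := unitaryGroupOfFormCongrOfEq (starRingEnd ℂ) T (Ha.map w.1.embedding) ((Matrix.diagonal ![(1 : L), -1]).map w.1.embedding) h with hΦdef
  have hΦ : ∀ g : unitaryGroupOfForm (starRingEnd ℂ) ((Matrix.diagonal ![(1 : L), -1]).map w.1.embedding),
      ((Φ g : unitaryGroupOfForm (starRingEnd ℂ) (Ha.map w.1.embedding)) : GL (Fin 2) ℂ) = T * (g : GL (Fin 2) ℂ) * T⁻¹ := fun g => rfl
  have hmap := map_conj_archLocalTopFormHaar L 2 Ha (Matrix.diagonal ![(1 : L), -1]) hHa (isUnit_iff_ne_zero.2 hdet) hherm₂ hdet₂ w h Φ hΦ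
  have hF : Measurable fun u : ↥(archLocal L 2 Ha w) =>
      ENNReal.ofReal (((‖(((T⁻¹ : GL (Fin 2) ℂ) : Matrix (Fin 2) (Fin 2) ℂ) * ((u : GL (Fin 2) ℂ) : Matrix (Fin 2) (Fin 2) ℂ) * (T : Matrix (Fin 2) (Fin 2) ℂ)) 0 0‖ ^ 2)⁻¹) ^ 2) := by
    have hc : Continuous fun u : ↥(archLocal L 2 Ha w) =>
        (((T⁻¹ : GL (Fin 2) ℂ) : Matrix (Fin 2) (Fin 2) ℂ) * ((u : GL (Fin 2) ℂ) : Matrix (Fin 2) (Fin 2) ℂ) * (T : Matrix (Fin 2) (Fin 2) ℂ)) 0 0 :=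
      ((continuous_const.matrix_mul (Units.continuous_val.comp continuous_subtype_val)).matrix_mul continuous_const).matrix_elem 0 0
    exact ENNReal.measurable_ofReal.comp (((hc.norm.measurable.pow_const 2).inv).pow_const 2)
  have hΦm : Measurable (Φ : unitaryGroupOfForm (starRingEnd ℂ) ((Matrix.diagonal ![(1 : L), -1]).map w.1.embedding) → unitaryGroupOfForm (starRingEnd ℂ) (Ha.map w.1.embedding)) :=
    (show Continuous (Φ : _ → unitaryGroupOfForm (starRingEnd ℂ) (Ha.map w.1.embedding)) from Φ.toHomeomorph.continuous).measurable
  rw [← hmap]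
  refine (lintegral_map (μ := archLocalTopFormHaar L 2 (Matrix.diagonal ![(1 : L), -1]) w) hF hΦm).trans ?_
  have hsimp : ∀ g : unitaryGroupOfForm (starRingEnd ℂ) ((Matrix.diagonal ![(1 : L), -1]).map w.1.embedding),
      ((T⁻¹ : GL (Fin 2) ℂ) : Matrix (Fin 2) (Fin 2) ℂ) * (((Φ g : unitaryGroupOfForm (starRingEnd ℂ) (Ha.map w.1.embedding)) : GL (Fin 2) ℂ) : Matrix (Fin 2) (Fin 2) ℂ) *
          (T : Matrix (Fin 2) (Fin 2) ℂ) = ((g : GL (Fin 2) ℂ) : Matrix (Fin 2) (Fin 2) ℂ) := by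
    intro g
    rw [hΦ g, Units.val_mul, Units.val_mul]
    simp only [Matrix.mul_assoc, Units.inv_mul, Matrix.mul_one]
    rw [← Matrix.mul_assoc, Units.inv_mul, Matrix.one_mul]
  simp_rw [hsimp]
  exact lintegral_inv_normSq_sq_archLocalTopFormHaar_diagonal L w

end Summit.HodgeConjecture.HodgeConjecture.Cruxes.H413.K2E5QuatArchLocal

end
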